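import Literature.NumberTheory.EllipticCurves.EisensteinWeightOneRowKernel
import Mathlib.Analysis.Calculus.ParametricIntegral
import Mathlib.Analysis.SpecialFunctions.ImproperIntegrals
import HarnessLib

/-!
# The constant-term integral `I₂(s) = ∫_ℝ (1 + u²)^{-1-s} du` of the weight-one Eisenstein rows

Topic `Literature/NumberTheory/EllipticCurves`; namespace
`Literature.NumberTheory.EllipticCurves.ModularForms`. One definition with a body (`constIntegral`)
and theorems; no named fact.

The full lattice row `∑_{d ∈ ℤ} (d+w)^{-1-s}(d+w̄)^{-s}` of Hecke's weight-one Eisenstein series has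
the "constant term" `c₀(s) (Im w)^{-2s}` with `c₀(s) = ∫_ℝ (u+i)^{-1-s}(u-i)^{-s} du = -i I₂(s)`,

  `I₂(s) = ∫_ℝ (1 + u²)^{-1-s} du`                                              (`constIntegral`)

(the next file proves `c₀ = -i I₂` by an integration by parts). Here: the integrand has norm
`(1+u²)^{-1-Re s}` (`norm_constIntegrand`), so `I₂(s)` converges absolutely for `Re s > -1/2`
(`integrable_constIntegrand`) with **`‖I₂(s)‖ ≤ ∫ (1+u²)^{-1-Re s}`** (`norm_constIntegral_le`);
**`I₂(0) = π`** (`constIntegral_zero`, Mathlib `integral_univ_inv_one_add_sq`); and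
**`s ↦ I₂(s)` is holomorphic on `Re s > -1/2`** (`differentiableOn_constIntegral`: differentiation
under the integral sign, the `s`-derivative `-log(1+u²)(1+u²)^{-1-s}` being dominated on small balls
by `δ⁻¹ (1+u²)^{δ-1-a}`). Classically `I₂(s) = √π Γ(s + 1/2)/Γ(s + 1)`; we do not need the closed
form.

## References

* E. Hecke, *Theorie der Eisensteinschen Reihen höherer Stufe…*, Abh. Math. Sem. Hamburg 5 (1927),
  §2 (the function `φ(y, s)`).
* B. Schoeneberg, *Elliptic Modular Functions*, Springer (1974), Ch. VII §2.
-/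

noncomputable section

open Complex Real Set MeasureTheory Filter Metric
open scoped Topology

namespace Literature.NumberTheory.EllipticCurves.ModularForms

/-- The integrand `(1 + u²)^{-1-s}` (complex power of a positive real). [folklore] -/
theorem one_add_sq_pos (u : ℝ) : (0 : ℝ) < 1 + u ^ 2 := by positivity

/-- **The constant-term integral** `I₂(s) = ∫_ℝ (1 + u²)^{-1-s} du`. [folklore] -/
def constIntegral (s : ℂ) : ℂ := ∫ u : ℝ, (((1 + u ^ 2 : ℝ)) : ℂ) ^ (-1 - s)

/-- `‖(1+u²)^{-1-s}‖ = (1+u²)^{-1-Re s}`. [folklore] -/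
theorem norm_constIntegrand (s : ℂ) (u : ℝ) :
    ‖(((1 + u ^ 2 : ℝ)) : ℂ) ^ (-1 - s)‖ = (1 + u ^ 2) ^ (-1 - s.re) := by
  rw [Complex.norm_cpow_eq_rpow_re_of_pos (one_add_sq_pos u)]
  simp

/-- The integrand is continuous in `u`. [folklore] -/
theorem continuous_constIntegrand (s : ℂ) :
    Continuous fun u : ℝ ↦ (((1 + u ^ 2 : ℝ)) : ℂ) ^ (-1 - s) := by
  refine Continuous.cpow (by fun_prop) continuous_const fun u ↦ ?_
  exact Or.inl (by exact_mod_cast one_add_sq_pos u)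

/-- **Absolute convergence for `Re s > -1/2`.** [folklore] -/
theorem integrable_constIntegrand {s : ℂ} (hs : -1 / 2 < s.re) :
    Integrable fun u : ℝ ↦ (((1 + u ^ 2 : ℝ)) : ℂ) ^ (-1 - s) := by
  refine ⟨(continuous_constIntegrand s).aestronglyMeasurable, ?_⟩
  have h := integrable_one_add_sq_rpow (a := 2 + 2 * s.re) (by linarith)
  refine (h.hasFiniteIntegral.congr' (Eventually.of_forall fun u ↦ ?_))
  rw [norm_constIntegrand]
  rw [Real.norm_of_nonneg (Real.rpow_nonneg (one_add_sq_pos u).le _)]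
  congr 1; ring

/-- **`‖I₂(s)‖ ≤ ∫ (1+u²)^{-1-Re s}`** (`= I(2 + 2 Re s)` in the notation of the row bounds).
[folklore] -/
theorem norm_constIntegral_le (s : ℂ) :
    ‖constIntegral s‖ ≤ ∫ u : ℝ, (1 + u ^ 2) ^ (-1 - s.re) := by
  unfold constIntegral
  refine (norm_integral_le_integral_norm _).trans (le_of_eq ?_)
  exact integral_congr_ae (Eventually.of_forall fun u ↦ norm_constIntegrand s u)

/-- **`I₂(0) = π`.** [folklore] -/
theorem constIntegral_zero : constIntegral 0 = π := by
  unfold constIntegral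
  have h : ∀ u : ℝ, (((1 + u ^ 2 : ℝ)) : ℂ) ^ (-1 - (0 : ℂ)) = (((1 + u ^ 2)⁻¹ : ℝ) : ℂ) := by
    intro u
    rw [sub_zero, cpow_neg_one, ← ofReal_inv]
  simp_rw [h]
  rw [integral_complex_ofReal, integral_univ_inv_one_add_sq]

/-! ### Holomorphy in `s` -/

/-- The `s`-derivative of the integrand: `d/ds (1+u²)^{-1-s} = -(1+u²)^{-1-s} log(1+u²)`. [folklore] -/
theorem hasDerivAt_constIntegrand (u : ℝ) (s : ℂ) :
    HasDerivAt (fun s : ℂ ↦ (((1 + u ^ 2 : ℝ)) : ℂ) ^ (-1 - s))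
      (-((((1 + u ^ 2 : ℝ)) : ℂ) ^ (-1 - s) * Complex.log (((1 + u ^ 2 : ℝ)) : ℂ))) s := by
  have hc : (((1 + u ^ 2 : ℝ)) : ℂ) ≠ 0 := by exact_mod_cast (one_add_sq_pos u).ne'
  have h1 := (Complex.hasStrictDerivAt_const_cpow (x := (((1 + u ^ 2 : ℝ)) : ℂ)) (y := -1 - s)
    (Or.inl hc)).hasDerivAt
  have h2 : HasDerivAt (fun s : ℂ ↦ -1 - s) (-1) s := by
    simpa using (hasDerivAt_id s).const_sub (-1 : ℂ)
  have h := h1.comp s h2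
  convert h using 1 <;> first | rfl | ring

/-- `log(1 + u²) ≤ (1+u²)^δ/δ` and hence the derivative bound on a half-plane `Re s > a`:
`‖(1+u²)^{-1-s} log(1+u²)‖ ≤ δ⁻¹ (1+u²)^{δ-1-a}`. [folklore] -/
theorem norm_deriv_constIntegrand_le {a δ : ℝ} (hδ : 0 < δ) {s : ℂ} (hs : a < s.re) (u : ℝ) :
    ‖-((((1 + u ^ 2 : ℝ)) : ℂ) ^ (-1 - s) * Complex.log (((1 + u ^ 2 : ℝ)) : ℂ))‖ ≤
      δ⁻¹ * (1 + u ^ 2) ^ (δ - 1 - a) := by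
  have hpos := one_add_sq_pos u
  have h1 : 1 ≤ 1 + u ^ 2 := by nlinarith [sq_nonneg u]
  rw [norm_neg, norm_mul, norm_constIntegrand, ← ofReal_log hpos.le, Complex.norm_real,
    Real.norm_of_nonneg (Real.log_nonneg h1)]
  have hlog : Real.log (1 + u ^ 2) ≤ (1 + u ^ 2) ^ δ / δ := Real.log_le_rpow_div hpos.le hδ
  have hpow : (1 + u ^ 2) ^ (-1 - s.re) ≤ (1 + u ^ 2) ^ (-1 - a) :=
    Real.rpow_le_rpow_of_exponent_le h1 (by linarith)
  calc (1 + u ^ 2) ^ (-1 - s.re) * Real.log (1 + u ^ 2)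
      ≤ (1 + u ^ 2) ^ (-1 - a) * ((1 + u ^ 2) ^ δ / δ) :=
        mul_le_mul hpow hlog (Real.log_nonneg h1) (Real.rpow_nonneg hpos.le _)
    _ = δ⁻¹ * (1 + u ^ 2) ^ (δ - 1 - a) := by
        rw [show δ - 1 - a = (-1 - a) + δ by ring, Real.rpow_add hpos]
        field_simp

/-- **`s ↦ I₂(s)` is complex differentiable at every `s` with `Re s > -1/2`** (differentiation under
the integral sign). [folklore] -/
theorem hasDerivAt_constIntegral {s₀ : ℂ} (hs₀ : -1 / 2 < s₀.re) :
    HasDerivAt constIntegral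
      (∫ u : ℝ, -((((1 + u ^ 2 : ℝ)) : ℂ) ^ (-1 - s₀) * Complex.log (((1 + u ^ 2 : ℝ)) : ℂ))) s₀ := by
  -- a half-plane neighbourhood `Re s > a` with `-1/2 < a < Re s₀`, and `δ = (a + 1/2)/2`
  set a : ℝ := (-1 / 2 + s₀.re) / 2 with ha
  have ha1 : -1 / 2 < a := by rw [ha]; linarith
  have ha2 : a < s₀.re := by rw [ha]; linarith
  set δ : ℝ := (a + 1 / 2) / 2 with hδ
  have hδ0 : 0 < δ := by rw [hδ]; linarith
  set U : Set ℂ := {s : ℂ | a < s.re} with hU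
  have hUn : U ∈ 𝓝 s₀ := (isOpen_lt continuous_const Complex.continuous_re).mem_nhds ha2
  have hmeas : ∀ᶠ s in 𝓝 s₀,
      AEStronglyMeasurable (fun u : ℝ ↦ (((1 + u ^ 2 : ℝ)) : ℂ) ^ (-1 - s)) volume :=
    Eventually.of_forall fun s ↦ (continuous_constIntegrand s).aestronglyMeasurable
  have hint : Integrable (fun u : ℝ ↦ (((1 + u ^ 2 : ℝ)) : ℂ) ^ (-1 - s₀)) := integrable_constIntegrand hs₀
  have hlogc : Continuous fun u : ℝ ↦ Complex.log (((1 + u ^ 2 : ℝ)) : ℂ) := by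
    have : (fun u : ℝ ↦ Complex.log (((1 + u ^ 2 : ℝ)) : ℂ)) =
        fun u ↦ ((Real.log (1 + u ^ 2) : ℝ) : ℂ) := by
      funext u; rw [ofReal_log (one_add_sq_pos u).le]
    rw [this]
    exact continuous_ofReal.comp
      ((show Continuous fun u : ℝ ↦ 1 + u ^ 2 by fun_prop).log fun u ↦ (one_add_sq_pos u).ne')
  have hmeas' : AEStronglyMeasurable (fun u : ℝ ↦
      -((((1 + u ^ 2 : ℝ)) : ℂ) ^ (-1 - s₀) * Complex.log (((1 + u ^ 2 : ℝ)) : ℂ))) volume :=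
    ((continuous_constIntegrand s₀).mul hlogc).neg.aestronglyMeasurable
  have hbound : ∀ᵐ u : ℝ, ∀ s ∈ U,
      ‖-((((1 + u ^ 2 : ℝ)) : ℂ) ^ (-1 - s) * Complex.log (((1 + u ^ 2 : ℝ)) : ℂ))‖ ≤
        δ⁻¹ * (1 + u ^ 2) ^ (δ - 1 - a) :=
    Eventually.of_forall fun u s hs ↦ norm_deriv_constIntegrand_le hδ0 hs u
  have hbint : Integrable fun u : ℝ ↦ δ⁻¹ * (1 + u ^ 2) ^ (δ - 1 - a) := by
    have h := (integrable_one_add_sq_rpow (a := 2 + 2 * a - 2 * δ) (by rw [hδ]; linarith)).const_mul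
      δ⁻¹
    refine h.congr (Eventually.of_forall fun u ↦ ?_)
    simp only
    congr 2; ring
  have hdiff : ∀ᵐ u : ℝ, ∀ s ∈ U, HasDerivAt (fun s : ℂ ↦ (((1 + u ^ 2 : ℝ)) : ℂ) ^ (-1 - s))
      (-((((1 + u ^ 2 : ℝ)) : ℂ) ^ (-1 - s) * Complex.log (((1 + u ^ 2 : ℝ)) : ℂ))) s :=
    Eventually.of_forall fun u s _ ↦ hasDerivAt_constIntegrand u s
  exact (hasDerivAt_integral_of_dominated_loc_of_deriv_le hUn hmeas hint hmeas' hbound hbint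
    hdiff).2

/-- **`s ↦ I₂(s)` is holomorphic on `Re s > -1/2`.** [folklore] -/
theorem differentiableOn_constIntegral :
    DifferentiableOn ℂ constIntegral {s : ℂ | -1 / 2 < s.re} := fun _ hs ↦
  (hasDerivAt_constIntegral hs).differentiableAt.differentiableWithinAt

/-- `s ↦ I₂(s)` is complex differentiable at every `s` with `Re s > -1/2`. [folklore] -/
theorem differentiableAt_constIntegral {s : ℂ} (hs : -1 / 2 < s.re) :
    DifferentiableAt ℂ constIntegral s :=
  (hasDerivAt_constIntegral hs).differentiableAt

/-- `s ↦ I₂(s)` is continuous at every `s` with `Re s > -1/2`. [folklore] -/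
theorem continuousAt_constIntegral {s : ℂ} (hs : -1 / 2 < s.re) : ContinuousAt constIntegral s :=
  (differentiableAt_constIntegral hs).continuousAt

end Literature.NumberTheory.EllipticCurves.ModularForms
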